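import Literature.NumberTheory.GaloisRepresentations.WildInertiaTameStructure
import Literature.GroupTheory.ProP.NormalGeneratorsProfinite
import HarnessLib

/-!
# Normal subgroups of index `p` of `Γ_F` are open (`F` a `p`-adic field)

Let `F` be a non-archimedean local field of characteristic `0` with residue characteristic `p`, and let
`Γ_F = Gal(F̄/F)` be topologically finitely generated (unconditional: `Summits/ABC/IUTFork/MLFGaloisTFG.lean`).

* `exists_topologicalClosure_normalClosure_eq_absWildInertia` — **the wild inertia group `P_F` is the
  topological normal closure in `Γ_F` of finitely many (`d + 2`) of its elements** (Iwasawa 1955 /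
  Jannsen–Wingberg 1982 §1; here by compactness from the tame structure, tree files
  `WildInertiaTameStructure`, `NormalGeneratorsProfinite`);
* `exists_openNormalSubgroup_inf_absWildInertia_le` — hence, by the operator form of Serre's lemma
  (`OperatorFrattiniOpen`), the ABSTRACT subgroup `⟨w^p, ⁅w, c⁆ : w ∈ P_F, c ∈ Γ_F⟩` contains
  `U ∩ P_F` for some open normal `U ≤ Γ_F`;
* `isOpen_of_normal_of_index_eq_ringChar` — **every (abstract) normal subgroup `N ⊴ Γ_F` of index `p`
  is open**: `N ⊇ ⟨w^p, ⁅w, c⁆⟩ ⊇ U ∩ P_F`, and finite-index subgroups containing `U ∩ P_F` are open by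
  the strong completeness of the tame quotient (abc-iut-w5-d200,
  `MLFGaloisTameStronglyComplete.isOpen_of_finiteIndex_of_le_of_isOpen`).

This is the `V = Γ_F` case of the right-hand side of
`MLFGaloisTameStronglyComplete.forall_finiteIndex_isOpen_iff_index_p` (the residual of FACT F-1977 at
`G_k`, abc-iut GAP row G-L3d2g2-1); the general open `V` follows by transport to `Γ_E`, `E/F` finite
(sibling file).  Classical (the `p`-adic instance of Nikolov–Segal by an elementary route); nothing here
bears on [IUTchIII] Cor. 3.12.  Proof-only (no definitions).
[cite: SerreGaloisCohomology1997, I §4.2 ex. 6] [cite: JannsenWingberg1982, §1]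
[cite: NeukirchSchmidtWingberg2008, Thm. 7.5.3]
-/

noncomputable section

open scoped Pointwise Valued commutatorElement
open Field ValuativeRel

namespace Literature.NumberTheory.GaloisRepresentations

open GaloisRepresentations.IsNonarchimedeanLocalField
open Literature.AnabelianGeometry.AbsoluteAnabelian
open Literature.GroupTheory.ProP

universe u

variable (F : Type u) [Field F] [ValuativeRel F] [TopologicalSpace F] [IsNonarchimedeanLocalField F]

/-- A topologically finitely generated group has a finite generating FAMILY `g : Fin d → G` of a dense
subgroup (repackaging of `IsTopologicallyFinitelyGenerated`). [cite: NeukirchSchmidtWingberg2008, Thm. 7.5.10] -/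
theorem exists_fin_topologicalClosure_closure_range_eq_top {G : Type u} [Group G] [TopologicalSpace G]
    [IsTopologicalGroup G] (hG : IsTopologicallyFinitelyGenerated G) :
    ∃ (d : ℕ) (g : Fin d → G), (Subgroup.closure (Set.range g)).topologicalClosure = ⊤ := by
  classical
  obtain ⟨s, hs⟩ := hG.exists_finset
  refine ⟨s.card, fun i => (s.equivFin.symm i : G), ?_⟩
  have hrange : Set.range (fun i => (s.equivFin.symm i : G)) = (s : Set G) := by
    ext x
    constructor
    · rintro ⟨i, rfl⟩; exact (s.equivFin.symm i).2
    · intro hx; exact ⟨s.equivFin ⟨x, hx⟩, by simp⟩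
  rw [hrange, hs]

/-- **The wild inertia group is topologically normally finitely generated in `Γ_F`**: for `F` of
characteristic `0` with `Γ_F` topologically generated by `d` elements and `ϖ` a uniformiser, `P_F` is
the closure of the normal closure of `d + 2` of its elements.
[cite: JannsenWingberg1982, §1] [cite: NeukirchSchmidtWingberg2008, Thm. 7.5.3] -/
theorem exists_topologicalClosure_normalClosure_eq_absWildInertia [CharZero F]
    {d : ℕ} {g : Fin d → absoluteGaloisGroup F}
    (hg : (Subgroup.closure (Set.range g)).topologicalClosure = ⊤) {ϖ : 𝒪[F]} (hϖ : Irreducible ϖ) :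
    ∃ y : Fin (d + 2) → absoluteGaloisGroup F, (∀ a, y a ∈ absWildInertia F ϖ) ∧
      (Subgroup.normalClosure (Set.range y)).topologicalClosure = absWildInertia F ϖ := by
  classical
  haveI hp : Fact (ringChar 𝓀[F]).Prime := ⟨ringChar_residueField_prime (F := F)⟩
  haveI : (absWildInertia F ϖ).Normal := absWildInertia_normal F ϖ
  have hPc := MLFGaloisTameStronglyComplete.isClosed_absWildInertia F ϖ
  obtain ⟨φ, hφ⟩ := exists_isAbsArithFrob_holds F
  obtain ⟨f, -, hf⟩ := residueFieldCard_eq_pow_ringChar F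
  have hrel : ∀ t ∈ absInertia F,
      φ * t * φ⁻¹ * (t ^ (ringChar 𝓀[F] ^ f))⁻¹ ∈ absWildInertia F ϖ := by
    intro t ht
    rw [← hf]
    exact frob_conj_mul_pow_inv_mem_absWildInertia F hϖ.ne_zero hφ ht
  exact Literature.GroupTheory.ProP.exists_topologicalClosure_normalClosure_eq hPc
    (absWildInertia_pow_mem_of_isOpen F hϖ) hg (I := absInertia F) hrel
    (exists_frob_mk_eq_zpow_mul F hφ)
    (fun U hU => isCyclic_map_absInertia_of_absWildInertia_le F hϖ.ne_zero U hU)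

/-- **Operator Serre lemma for the wild inertia group**: for `F` of characteristic `0` with `Γ_F`
topologically finitely generated and `ϖ` a uniformiser, some open normal subgroup `U` of `Γ_F` has
`U ∩ P_F ⊆ ⟨w ^ p, ⁅w, c⁆ : w ∈ P_F, c ∈ Γ_F⟩` (abstract subgroup).
[cite: SerreGaloisCohomology1997, I §4.2 ex. 6] [cite: JannsenWingberg1982, §1] -/
theorem exists_openNormalSubgroup_inf_absWildInertia_le [CharZero F]
    (hG : IsTopologicallyFinitelyGenerated (absoluteGaloisGroup F)) {ϖ : 𝒪[F]} (hϖ : Irreducible ϖ) :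
    ∃ U : OpenNormalSubgroup (absoluteGaloisGroup F), (U : Subgroup (absoluteGaloisGroup F)) ⊓ absWildInertia F ϖ ≤
      Subgroup.closure
        ({x | ∃ w ∈ absWildInertia F ϖ, w ^ ringChar 𝓀[F] = x} ∪
          {x | ∃ w ∈ absWildInertia F ϖ, ∃ c : absoluteGaloisGroup F, ⁅w, c⁆ = x}) := by
  classical
  haveI hp : Fact (ringChar 𝓀[F]).Prime := ⟨ringChar_residueField_prime (F := F)⟩
  haveI : (absWildInertia F ϖ).Normal := absWildInertia_normal F ϖ
  have hPc := MLFGaloisTameStronglyComplete.isClosed_absWildInertia F ϖ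
  obtain ⟨d, g, hg⟩ := exists_fin_topologicalClosure_closure_range_eq_top hG
  obtain ⟨y, hy, hyP⟩ := exists_topologicalClosure_normalClosure_eq_absWildInertia F hg hϖ
  exact exists_openNormalSubgroup_inf_le_operatorFrattini hPc (absWildInertia_pow_mem_of_isOpen F hϖ)
    hg hy hyP

/-- **Every normal subgroup of `Γ_F` of index `p` is open** (`F` of characteristic `0` with residue
characteristic `p`, `Γ_F` topologically finitely generated; `N` an ABSTRACT normal subgroup).  The
quotient `Γ_F ⧸ N` has prime order, so it is cyclic and kills `p`-th powers and commutators; hence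
`N ⊇ U ∩ P_F` for the open normal `U` of `exists_openNormalSubgroup_inf_absWildInertia_le`, and
`N ∩ U` is open by the strong completeness of the tame quotient
(`MLFGaloisTameStronglyComplete.isOpen_of_finiteIndex_of_le_of_isOpen`).
[cite: SerreGaloisCohomology1997, I §4.2 ex. 6] [cite: NeukirchSchmidtWingberg2008, Thm. 7.5.3] -/
theorem isOpen_of_normal_of_index_eq_ringChar [CharZero F]
    (hG : IsTopologicallyFinitelyGenerated (absoluteGaloisGroup F))
    (N : Subgroup (absoluteGaloisGroup F)) [N.Normal] (hN : N.index = ringChar 𝓀[F]) :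
    IsOpen (N : Set (absoluteGaloisGroup F)) := by
  classical
  set p := ringChar 𝓀[F] with hpdef
  haveI hp : Fact p.Prime := ⟨ringChar_residueField_prime (F := F)⟩
  haveI : CompactSpace (absoluteGaloisGroup F) := absoluteGaloisGroup_compactSpace F
  obtain ⟨ϖ, hϖ⟩ := IsDiscreteValuationRing.exists_irreducible 𝒪[F]
  set P := absWildInertia F ϖ with hPdef
  obtain ⟨U, hU⟩ := exists_openNormalSubgroup_inf_absWildInertia_le F hG hϖ
  -- `Γ_F ⧸ N` is cyclic of order `p`: it kills `p`-th powers and commutators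
  haveI : N.FiniteIndex := ⟨by rw [hN]; exact hp.out.ne_zero⟩
  have hcard : Nat.card (absoluteGaloisGroup F ⧸ N) = p := hN
  haveI : IsCyclic (absoluteGaloisGroup F ⧸ N) := isCyclic_of_prime_card hcard
  have hpow : ∀ w : absoluteGaloisGroup F, w ^ p ∈ N := fun w => by
    rw [← QuotientGroup.eq_one_iff, QuotientGroup.mk_pow, ← hcard, pow_card_eq_one']
  have hcomm : ∀ w c : absoluteGaloisGroup F, ⁅w, c⁆ ∈ N := fun w c => by
    rw [← QuotientGroup.eq_one_iff, ← QuotientGroup.mk'_apply, map_commutatorElement,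
      commutatorElement_eq_one_iff_commute]
    obtain ⟨γ, hγ⟩ := IsCyclic.exists_generator (α := absoluteGaloisGroup F ⧸ N)
    obtain ⟨a, ha⟩ := Subgroup.mem_zpowers_iff.mp (hγ (QuotientGroup.mk' N w))
    obtain ⟨b, hb⟩ := Subgroup.mem_zpowers_iff.mp (hγ (QuotientGroup.mk' N c))
    rw [← ha, ← hb]
    exact Commute.zpow_zpow_self γ a b
  have hMN : Subgroup.closure
      ({x | ∃ w ∈ P, w ^ p = x} ∪ {x | ∃ w ∈ P, ∃ c : absoluteGaloisGroup F, ⁅w, c⁆ = x}) ≤ N := by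
    rw [Subgroup.closure_le]
    rintro _ (⟨w, -, rfl⟩ | ⟨w, -, c, rfl⟩)
    · exact hpow w
    · exact hcomm w c
  -- `N ⊓ U ⊇ P ⊓ U` is open by the tame strong completeness inside `U`
  haveI : Finite (absoluteGaloisGroup F ⧸ U.toSubgroup) :=
    Subgroup.quotient_finite_of_isOpen U.toSubgroup U.isOpen
  haveI : (U.toSubgroup).FiniteIndex := Subgroup.finiteIndex_of_finite_quotient
  haveI : (N ⊓ U.toSubgroup).FiniteIndex := inferInstance
  have hopen : IsOpen ((N ⊓ U.toSubgroup : Subgroup (absoluteGaloisGroup F)) :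
      Set (absoluteGaloisGroup F)) := by
    refine MLFGaloisTameStronglyComplete.isOpen_of_finiteIndex_of_le_of_isOpen F hG hϖ
      (V := U.toSubgroup) U.isOpen inf_le_right ?_
    intro x hx
    exact ⟨hMN (hU ⟨hx.2, hx.1⟩), hx.2⟩
  exact Subgroup.isOpen_mono inf_le_left hopen

end Literature.NumberTheory.GaloisRepresentations

end
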